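import Summits.MatrixMultiplication.MatrixMultiplication.Theorems.ObstructionDescentUniversalOccurrenceTwoRectangleHookTableaux

set_option linter.dupNamespace false
set_option autoImplicit false

/-!
# Universal occurrence — two rectangles and TWO COLUMN PAIRS, part H: the pair tableau of `(2N-4,4)` (decomp-mm · lens 3 · gen 43)

Route `route-MatrixMultiplication-ObstructionDescent` (sub-problem `MatrixMultiplication`, `ω(ℂ) = 2`); SUPPORT for the crux
`NoOccurrenceObstruction` (`P_O`, item `stmt-MatrixMultiplication-29040`) through the universal-occurrence programme (NODE-g29…g43
of the decomp-mm cell, lens 3).  Nothing here proves `ω = 2` or closes an item; no `def`, no `sorry`, standard axioms.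

**Why.**  With the hook series (`occurs_unitTensor_twoRectangle_doubleHook`, `j ≤ 3`) and the families `(2N-6,4,2)`, `(2N-8,4,2,2)`
(parts A–G) the only types `((2^N),(2^N),ν)` of the two-rectangular sector with `ν₂ ≤ 4`, `ν₃ ≤ 2` not yet certified in Lean are
the two-row types `(2N-4,4)`.  Parts H, I settle them (`m ≥ N ≥ 4`) with the same device: two column pairs of height `2`, no twist,
every term of the floor-law sum `0` or `+1` (twins, and anti-twins as even column swaps of twins).

**This file: the pair tableau `T` of `(2N-4,4)` and its evaluations.**  Positions `0,1 ↦` column `0` (rows `0,1`), `2,3 ↦` column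
`1`, `4,5 ↦` column `2`, `6,7 ↦` column `3`, `q ≥ 8 ↦ (0,q-4)` (`dominoCell_*`, `mem_youngDiagram_twoRowsFour`).  Support
(`dominoTableau_support`): arm letters `0`, letters `< 2` on the positions `< 8`, columns injective; twins (`u (p+2) = u p` for
`p = 0, 1` and `p = 4, 5`) evaluate to `1` (`dominoTableau_twin_eq_one`); `e_T(u ∘ (2 3)(6 7)) = e_T(u)` (`dominoTableau_evenSwap`).

[cite: BurgisserIkenmeyer2011, §3.4 (Prop. 3.4), Thm. 4.4] [cite: BurgisserIkenmeyer2017, §5, Thm. 5.9 (proof of (2)), eq. (3.4)]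
[cite: Landsberg2017, §9.1.1]
-/

noncomputable section

open scoped BigOperators

namespace Summit.MatrixMultiplication.MatrixMultiplication.Theorems.ObstructionCalculus

open Literature.Computability.AlgebraicComplexity
open Literature.NumberTheory.DiophantineGeometry

/-! ### §1 The pair tableau of `(2N-4, 4)` -/

/-- Cells of the pair tableau are distinct. [folklore] -/
theorem dominoCell_injective {p q : ℕ}
    (hpq : (if p < 2 then (p, 0) else if p < 4 then (p - 2, 1) else if p < 6 then (p - 4, 2)
        else if p < 8 then (p - 6, 3) else (0, p - 4) : ℕ × ℕ) =
      (if q < 2 then (q, 0) else if q < 4 then (q - 2, 1) else if q < 6 then (q - 4, 2)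
        else if q < 8 then (q - 6, 3) else (0, q - 4))) : p = q := by
  split_ifs at hpq <;> simp only [Prod.mk.injEq] at hpq <;> omega

/-- The pair tableau is a standard filling for the position order. [folklore] -/
theorem dominoCell_standard {p q : ℕ} (hpq : p < q) :
    ¬ ((if q < 2 then (q, 0) else if q < 4 then (q - 2, 1) else if q < 6 then (q - 4, 2)
        else if q < 8 then (q - 6, 3) else (0, q - 4) : ℕ × ℕ) ≤
      (if p < 2 then (p, 0) else if p < 4 then (p - 2, 1) else if p < 6 then (p - 4, 2)
        else if p < 8 then (p - 6, 3) else (0, p - 4))) := by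
  split_ifs <;> simp only [Prod.mk_le_mk] <;> omega

/-- The Young diagram of `(2N-4,4)`: its boxes. [folklore] -/
theorem mem_youngDiagram_twoRowsFour {N : ℕ} (ν : Nat.Partition (N * 2))
    (hν : ν.sortedParts = [2 * N - 4, 4]) {r c : ℕ}
    (h : (r = 0 ∧ c < 2 * N - 4) ∨ (r = 1 ∧ c < 4)) :
    (r, c) ∈ ν.youngDiagram := by
  rw [Nat.Partition.mem_youngDiagram_iff, hν]
  rcases h with ⟨rfl, hc⟩ | ⟨rfl, hc⟩
  · exact ⟨by simp, by simpa using hc⟩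
  · exact ⟨by simp, by simpa using hc⟩

/-- `(2N-4,4)` has two rows. [folklore] -/
theorem fst_lt_of_mem_youngDiagram_twoRowsFour {N : ℕ} (ν : Nat.Partition (N * 2))
    (hν : ν.sortedParts = [2 * N - 4, 4]) {x : ℕ × ℕ}
    (hx : x ∈ ν.youngDiagram.cells) : x.1 < 2 := by
  obtain ⟨h, -⟩ := (Nat.Partition.mem_youngDiagram_iff ν x).1 ((YoungDiagram.mem_cells _).1 hx)
  rw [hν] at h
  simpa using h

/-- The cells of the pair tableau lie in `(2N-4,4)` (`4 ≤ N`). [folklore] -/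
theorem dominoCell_mem_twoRowsFour {N : ℕ} (hN : 4 ≤ N) (ν : Nat.Partition (N * 2))
    (hν : ν.sortedParts = [2 * N - 4, 4]) (p : ℕ) (hp : p < N * 2) :
    (if p < 2 then (p, 0) else if p < 4 then (p - 2, 1) else if p < 6 then (p - 4, 2)
        else if p < 8 then (p - 6, 3) else (0, p - 4) : ℕ × ℕ) ∈ ν.youngDiagram := by
  split_ifs with h1 h2 h3 h4 <;> apply mem_youngDiagram_twoRowsFour ν hν
  · rcases (show p = 0 ∨ p = 1 by omega) with rfl | rfl
    · left; constructor <;> omega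
    · right; constructor <;> omega
  · rcases (show p = 2 ∨ p = 3 by omega) with rfl | rfl
    · left; constructor <;> omega
    · right; constructor <;> omega
  · rcases (show p = 4 ∨ p = 5 by omega) with rfl | rfl
    · left; constructor <;> omega
    · right; constructor <;> omega
  · rcases (show p = 6 ∨ p = 7 by omega) with rfl | rfl
    · left; constructor <;> omega
    · right; constructor <;> omega
  · left; constructor <;> omega

/-! ### §2 Support, twins and even swaps -/

/-- **Support of `e_T`.**  If `e_T(u) ≠ 0` then `u` vanishes on the arm, has letters `< 2` on the positions `< 8`, and is injective
on every column. [folklore] -/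
theorem dominoTableau_support {N : ℕ} {Y : YoungDiagram} (hN : ∀ x ∈ Y.cells, x.1 < N)
    (T : StdFilling (N * 2) Y)
    (hT : ∀ p : Fin (N * 2), T.1 p = (if (p : ℕ) < 2 then ((p : ℕ), 0) else if (p : ℕ) < 4 then ((p : ℕ) - 2, 1)
      else if (p : ℕ) < 6 then ((p : ℕ) - 4, 2) else if (p : ℕ) < 8 then ((p : ℕ) - 6, 3) else (0, (p : ℕ) - 4)))
    {u : Word N (N * 2)} (hu : T.polytabloid ℂ hN u ≠ 0) :
    (∀ p : Fin (N * 2), 8 ≤ (p : ℕ) → ((u p : Fin N) : ℕ) = 0) ∧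
    (∀ p : Fin (N * 2), (p : ℕ) < 8 → ((u p : Fin N) : ℕ) < 2) ∧
    (∀ p q : Fin (N * 2), (T.1 p).2 = (T.1 q).2 → u p = u q → p = q) := by
  classical
  obtain ⟨σ, hσ, rfl⟩ := StdFilling.exists_of_polytabloid_apply_ne_zero hN T hu
  have hcol : ∀ p, (T.1 (σ p)).2 = (T.1 p).2 := StdFilling.mem_colStab.1 hσ
  have hval : ∀ p, ((StdFilling.rowWord hN T ∘ ⇑σ) p : ℕ) = (T.1 (σ p)).1 := fun p => rfl
  have hrow' : ∀ q : Fin (N * 2), (T.1 q).1 =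
      if (q : ℕ) < 2 then (q : ℕ) else if (q : ℕ) < 4 then (q : ℕ) - 2
      else if (q : ℕ) < 6 then (q : ℕ) - 4 else if (q : ℕ) < 8 then (q : ℕ) - 6 else 0 := fun q => by
    rw [hT]; split_ifs <;> rfl
  have hcol' : ∀ q : Fin (N * 2), (T.1 q).2 =
      if (q : ℕ) < 2 then 0 else if (q : ℕ) < 4 then 1
      else if (q : ℕ) < 6 then 2 else if (q : ℕ) < 8 then 3 else (q : ℕ) - 4 := fun q => by
    rw [hT]; split_ifs <;> rfl
  refine ⟨fun p hp => ?_, fun p hp => ?_, fun p q hpq hupq => ?_⟩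
  · have hc := hcol p
    rw [hcol', hcol'] at hc
    rw [hval, hrow']
    split_ifs at hc ⊢ <;> omega
  · have hc := hcol p
    rw [hcol', hcol'] at hc
    rw [hval, hrow']
    split_ifs at hc ⊢ <;> omega
  · have hr : (T.1 (σ p)).1 = (T.1 (σ q)).1 := by
      rw [← hval, ← hval]; exact congrArg Fin.val hupq
    have hc : (T.1 (σ p)).2 = (T.1 (σ q)).2 := by rw [hcol, hcol, hpq]
    exact σ.injective (T.injective (Prod.ext hr hc))

/-- **Twin words evaluate to `1`.**  If `u` vanishes on the arm, is injective with letters `< 2` on the columns `0` and `2`, and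
columns `1`, `3` repeat them (`u (p+2) = u p` for `p = 0, 1, 4, 5`), then `e_T(u) = 1` (`u = w_T ∘ ρ`, `ρ = ρ₀ · κρ₀κ`,
`sgn ρ = sgn(ρ₀)² = 1`). [folklore] -/
theorem dominoTableau_twin_eq_one {N : ℕ} {Y : YoungDiagram} (hN : ∀ x ∈ Y.cells, x.1 < N)
    (T : StdFilling (N * 2) Y)
    (hT : ∀ p : Fin (N * 2), T.1 p = (if (p : ℕ) < 2 then ((p : ℕ), 0) else if (p : ℕ) < 4 then ((p : ℕ) - 2, 1)
      else if (p : ℕ) < 6 then ((p : ℕ) - 4, 2) else if (p : ℕ) < 8 then ((p : ℕ) - 6, 3) else (0, (p : ℕ) - 4)))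
    (hh : 8 ≤ N * 2) {u : Word N (N * 2)}
    (harm : ∀ p : Fin (N * 2), 8 ≤ (p : ℕ) → ((u p : Fin N) : ℕ) = 0)
    (hlt0 : ∀ p : Fin (N * 2), (p : ℕ) < 2 → ((u p : Fin N) : ℕ) < 2)
    (hinj0 : ∀ p q : Fin (N * 2), (p : ℕ) < 2 → (q : ℕ) < 2 → u p = u q → p = q)
    (hlt2 : ∀ p : Fin (N * 2), 4 ≤ (p : ℕ) → (p : ℕ) < 6 → ((u p : Fin N) : ℕ) < 2)
    (hinj2 : ∀ p q : Fin (N * 2), 4 ≤ (p : ℕ) → (p : ℕ) < 6 → 4 ≤ (q : ℕ) → (q : ℕ) < 6 → u p = u q → p = q)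
    (htwin0 : ∀ (p : Fin (N * 2)) (hp : (p : ℕ) < 2), u ⟨p + 2, by omega⟩ = u p)
    (htwin2 : ∀ (p : Fin (N * 2)) (hp : 4 ≤ (p : ℕ)) (hp' : (p : ℕ) < 6), u ⟨p + 2, by omega⟩ = u p) :
    T.polytabloid ℂ hN u = 1 := by
  classical
  have hrow' : ∀ q : Fin (N * 2), (T.1 q).1 =
      if (q : ℕ) < 2 then (q : ℕ) else if (q : ℕ) < 4 then (q : ℕ) - 2
      else if (q : ℕ) < 6 then (q : ℕ) - 4 else if (q : ℕ) < 8 then (q : ℕ) - 6 else 0 := fun q => by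
    rw [hT]; split_ifs <;> rfl
  have hcol' : ∀ q : Fin (N * 2), (T.1 q).2 =
      if (q : ℕ) < 2 then 0 else if (q : ℕ) < 4 then 1
      else if (q : ℕ) < 6 then 2 else if (q : ℕ) < 8 then 3 else (q : ℕ) - 4 := fun q => by
    rw [hT]; split_ifs <;> rfl
  -- `ρ₀`: the permutation of the columns `0` and `2` realising `u` there
  let S := {p : Fin (N * 2) // (p : ℕ) < 2 ∨ (4 ≤ (p : ℕ) ∧ (p : ℕ) < 6)}
  have hS : ∀ x : S, ¬ ((x.1 : Fin (N * 2)) : ℕ) < 2 → 4 ≤ ((x.1 : Fin (N * 2)) : ℕ) ∧ ((x.1 : Fin (N * 2)) : ℕ) < 6 :=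
    fun x hx => by rcases x.2 with h | h <;> omega
  have hb0 : ∀ x : S, ((x.1 : Fin (N * 2)) : ℕ) < 2 → ((u x.1 : Fin N) : ℕ) < N * 2 :=
    fun x hx => by have := hlt0 x.1 hx; omega
  have hb2 : ∀ x : S, ¬ ((x.1 : Fin (N * 2)) : ℕ) < 2 → ((u x.1 : Fin N) : ℕ) + 4 < 6 :=
    fun x hx => by have := hlt2 x.1 (hS x hx).1 (hS x hx).2; omega
  let f₀ : S → S := fun x =>
    if hx : ((x.1 : Fin (N * 2)) : ℕ) < 2 then
      ⟨⟨((u x.1 : Fin N) : ℕ), hb0 x hx⟩, Or.inl (hlt0 x.1 hx)⟩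
    else
      ⟨⟨((u x.1 : Fin N) : ℕ) + 4, by have := hb2 x hx; omega⟩,
        Or.inr ⟨by simp, by have := hb2 x hx; simpa using this⟩⟩
  have hf₀v : ∀ x : S, ((f₀ x).1 : ℕ) =
      if ((x.1 : Fin (N * 2)) : ℕ) < 2 then ((u x.1 : Fin N) : ℕ) else ((u x.1 : Fin N) : ℕ) + 4 := by
    intro x
    by_cases hx : ((x.1 : Fin (N * 2)) : ℕ) < 2
    · simp only [f₀, dif_pos hx, if_pos hx]
    · simp only [f₀, dif_neg hx, if_neg hx]
  have hf₀ : Function.Injective f₀ := by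
    rintro ⟨p, hp⟩ ⟨q, hq⟩ hpq
    have h1 := congrArg (fun x : S => ((x.1 : Fin (N * 2)) : ℕ)) hpq
    simp only [hf₀v] at h1
    apply Subtype.ext
    by_cases hp3 : (p : ℕ) < 2 <;> by_cases hq3 : (q : ℕ) < 2
    · rw [if_pos hp3, if_pos hq3] at h1
      exact hinj0 p q hp3 hq3 (Fin.ext h1)
    · rw [if_pos hp3, if_neg hq3] at h1
      have := hlt0 p hp3; omega
    · rw [if_neg hp3, if_pos hq3] at h1
      have := hlt0 q hq3; omega
    · rw [if_neg hp3, if_neg hq3] at h1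
      exact hinj2 p q (by rcases hp with h | h <;> omega) (by rcases hp with h | h <;> omega)
        (by rcases hq with h | h <;> omega) (by rcases hq with h | h <;> omega) (Fin.ext (by omega))
  let F₀ : Equiv.Perm S := Equiv.ofBijective f₀ (Finite.injective_iff_bijective.1 hf₀)
  let ρ₀ : Equiv.Perm (Fin (N * 2)) := Equiv.Perm.ofSubtype F₀
  have hρ₀_0 : ∀ p : Fin (N * 2), (p : ℕ) < 2 → ((ρ₀ p : Fin (N * 2)) : ℕ) = ((u p : Fin N) : ℕ) := by
    intro p hp
    show ((Equiv.Perm.ofSubtype F₀ p : Fin (N * 2)) : ℕ) = _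
    rw [Equiv.Perm.ofSubtype_apply_of_mem F₀ (Or.inl hp)]
    show (((f₀ ⟨p, Or.inl hp⟩).1 : Fin (N * 2)) : ℕ) = _
    rw [hf₀v, if_pos hp]
  have hρ₀_2 : ∀ p : Fin (N * 2), 4 ≤ (p : ℕ) → (p : ℕ) < 6 →
      ((ρ₀ p : Fin (N * 2)) : ℕ) = ((u p : Fin N) : ℕ) + 4 := by
    intro p hp hp'
    show ((Equiv.Perm.ofSubtype F₀ p : Fin (N * 2)) : ℕ) = _
    rw [Equiv.Perm.ofSubtype_apply_of_mem F₀ (Or.inr ⟨hp, hp'⟩)]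
    show (((f₀ ⟨p, Or.inr ⟨hp, hp'⟩⟩).1 : Fin (N * 2)) : ℕ) = _
    rw [hf₀v, if_neg (by simp; omega)]
  have hρ₀_fix : ∀ p : Fin (N * 2), ¬ ((p : ℕ) < 2 ∨ (4 ≤ (p : ℕ) ∧ (p : ℕ) < 6)) → ρ₀ p = p := fun p hp =>
    Equiv.Perm.ofSubtype_apply_of_not_mem F₀ hp
  -- `κ`: the row-wise exchange of the two columns of each pair
  let kf : Fin (N * 2) → Fin (N * 2) := fun p =>
    if hp : (p : ℕ) < 2 then ⟨p + 2, by omega⟩ else if (p : ℕ) < 4 then ⟨p - 2, by omega⟩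
    else if hp' : (p : ℕ) < 6 then ⟨p + 2, by omega⟩ else if (p : ℕ) < 8 then ⟨p - 2, by omega⟩ else p
  have hkf : ∀ p, ((kf p : Fin (N * 2)) : ℕ) =
      if (p : ℕ) < 2 then (p : ℕ) + 2 else if (p : ℕ) < 4 then (p : ℕ) - 2
      else if (p : ℕ) < 6 then (p : ℕ) + 2 else if (p : ℕ) < 8 then (p : ℕ) - 2 else p := by
    intro p; simp only [kf]; split_ifs <;> rfl
  have hk : Function.Involutive kf := by
    intro p
    apply Fin.ext
    rw [hkf, hkf]
    split_ifs <;> omega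
  let κ : Equiv.Perm (Fin (N * 2)) := Function.Involutive.toPerm kf hk
  have hκ : ∀ p, ((κ p : Fin (N * 2)) : ℕ) =
      if (p : ℕ) < 2 then (p : ℕ) + 2 else if (p : ℕ) < 4 then (p : ℕ) - 2
      else if (p : ℕ) < 6 then (p : ℕ) + 2 else if (p : ℕ) < 8 then (p : ℕ) - 2 else p := hkf
  let ρ : Equiv.Perm (Fin (N * 2)) := ρ₀ * (κ * ρ₀ * κ)
  have hρ : ∀ p, ρ p = ρ₀ (κ (ρ₀ (κ p))) := fun p => rfl
  -- values of `ρ`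
  have hρ_0 : ∀ p : Fin (N * 2), (p : ℕ) < 2 → ((ρ p : Fin (N * 2)) : ℕ) = ((u p : Fin N) : ℕ) := by
    intro p hp
    have h1 : ((κ p : Fin (N * 2)) : ℕ) = p + 2 := by rw [hκ, if_pos hp]
    have h2 : ρ₀ (κ p) = κ p := hρ₀_fix _ (by omega)
    have h3 : κ (κ p) = p := hk p
    rw [hρ, h2, h3]
    exact hρ₀_0 p hp
  have hρ_1 : ∀ (p : Fin (N * 2)) (hp : 2 ≤ (p : ℕ)) (hp' : (p : ℕ) < 4),
      ((ρ p : Fin (N * 2)) : ℕ) = ((u ⟨p - 2, by omega⟩ : Fin N) : ℕ) + 2 := by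
    intro p hp hp'
    have h1 : ((κ p : Fin (N * 2)) : ℕ) = p - 2 := by rw [hκ, if_neg (by omega), if_pos hp']
    have h1' : κ p = ⟨p - 2, by omega⟩ := Fin.ext h1
    have h2 : ((ρ₀ (κ p) : Fin (N * 2)) : ℕ) = ((u ⟨p - 2, by omega⟩ : Fin N) : ℕ) := by
      rw [h1']; exact hρ₀_0 _ (by simp; omega)
    have hu' : ((u ⟨p - 2, by omega⟩ : Fin N) : ℕ) < 2 := hlt0 _ (by simp; omega)
    have h3 : ((κ (ρ₀ (κ p)) : Fin (N * 2)) : ℕ) = ((u ⟨p - 2, by omega⟩ : Fin N) : ℕ) + 2 := by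
      rw [hκ, h2, if_pos hu']
    have h4 : ρ₀ (κ (ρ₀ (κ p))) = κ (ρ₀ (κ p)) := hρ₀_fix _ (by rw [h3]; omega)
    rw [hρ, h4, h3]
  have hρ_2 : ∀ p : Fin (N * 2), 4 ≤ (p : ℕ) → (p : ℕ) < 6 →
      ((ρ p : Fin (N * 2)) : ℕ) = ((u p : Fin N) : ℕ) + 4 := by
    intro p hp hp'
    have h1 : ((κ p : Fin (N * 2)) : ℕ) = p + 2 := by rw [hκ, if_neg (by omega), if_neg (by omega), if_pos hp']
    have h2 : ρ₀ (κ p) = κ p := hρ₀_fix _ (by omega)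
    have h3 : κ (κ p) = p := hk p
    rw [hρ, h2, h3]
    exact hρ₀_2 p hp hp'
  have hρ_3 : ∀ (p : Fin (N * 2)) (hp : 6 ≤ (p : ℕ)) (hp' : (p : ℕ) < 8),
      ((ρ p : Fin (N * 2)) : ℕ) = ((u ⟨p - 2, by omega⟩ : Fin N) : ℕ) + 6 := by
    intro p hp hp'
    have h1 : ((κ p : Fin (N * 2)) : ℕ) = p - 2 := by
      rw [hκ, if_neg (by omega), if_neg (by omega), if_neg (by omega), if_pos hp']
    have h1' : κ p = ⟨p - 2, by omega⟩ := Fin.ext h1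
    have h2 : ((ρ₀ (κ p) : Fin (N * 2)) : ℕ) = ((u ⟨p - 2, by omega⟩ : Fin N) : ℕ) + 4 := by
      rw [h1']; exact hρ₀_2 _ (by simp; omega) (by simp; omega)
    have hu' : ((u ⟨p - 2, by omega⟩ : Fin N) : ℕ) < 2 := hlt2 _ (by simp; omega) (by simp; omega)
    have h3 : ((κ (ρ₀ (κ p)) : Fin (N * 2)) : ℕ) = ((u ⟨p - 2, by omega⟩ : Fin N) : ℕ) + 6 := by
      rw [hκ, h2, if_neg (by omega), if_neg (by omega), if_pos (by omega)]
    have h4 : ρ₀ (κ (ρ₀ (κ p))) = κ (ρ₀ (κ p)) := hρ₀_fix _ (by rw [h3]; omega)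
    rw [hρ, h4, h3]
  have hρ_ge : ∀ p : Fin (N * 2), 8 ≤ (p : ℕ) → ρ p = p := by
    intro p hp
    have h1 : κ p = p := Fin.ext (by rw [hκ]; split_ifs <;> omega)
    have h2 : ρ₀ p = p := hρ₀_fix _ (by omega)
    rw [hρ, h1, h2, h1, h2]
  -- `ρ` is a column permutation and `u = w_T ∘ ρ`
  have hρC : ρ ∈ T.colStab := by
    rw [StdFilling.mem_colStab]
    intro p
    rw [hcol', hcol']
    by_cases h0 : (p : ℕ) < 2
    · have := hρ_0 p h0
      have := hlt0 p h0
      rw [if_pos h0, if_pos (by omega)]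
    · by_cases h1 : (p : ℕ) < 4
      · have := hρ_1 p (by omega) h1
        have := hlt0 ⟨p - 2, by omega⟩ (by simp; omega)
        rw [if_neg h0, if_pos h1, if_neg (by omega), if_pos (by omega)]
      · by_cases h2 : (p : ℕ) < 6
        · have := hρ_2 p (by omega) h2
          have := hlt2 p (by omega) h2
          rw [if_neg h0, if_neg h1, if_pos h2, if_neg (by omega), if_neg (by omega), if_pos (by omega)]
        · by_cases h3 : (p : ℕ) < 8
          · have := hρ_3 p (by omega) h3
            have := hlt2 ⟨p - 2, by omega⟩ (by simp; omega) (by simp; omega)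
            rw [if_neg h0, if_neg h1, if_neg h2, if_pos h3, if_neg (by omega), if_neg (by omega), if_neg (by omega),
              if_pos (by omega)]
          · rw [hρ_ge p (by omega)]
  have hw : u = StdFilling.rowWord hN T ∘ ⇑ρ := by
    funext p
    apply Fin.ext
    show ((u p : Fin N) : ℕ) = (T.1 (ρ p)).1
    rw [hrow']
    by_cases h0 : (p : ℕ) < 2
    · have e1 := hρ_0 p h0
      have := hlt0 p h0
      rw [if_pos (by omega), e1]
    · by_cases h1 : (p : ℕ) < 4
      · have e1 := hρ_1 p (by omega) h1
        have := hlt0 ⟨p - 2, by omega⟩ (by simp; omega)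
        rw [if_neg (by omega), if_pos (by omega), e1, Nat.add_sub_cancel]
        have e2 := htwin0 ⟨p - 2, by omega⟩ (by simp; omega)
        have e3 : (⟨((⟨(p : ℕ) - 2, by omega⟩ : Fin (N * 2)) : ℕ) + 2, by simp; omega⟩ : Fin (N * 2)) = p :=
          Fin.ext (by simp; omega)
        rw [e3] at e2
        rw [e2]
      · by_cases h2 : (p : ℕ) < 6
        · have e1 := hρ_2 p (by omega) h2
          have := hlt2 p (by omega) h2
          rw [if_neg (by omega), if_neg (by omega), if_pos (by omega), e1, Nat.add_sub_cancel]
        · by_cases h3 : (p : ℕ) < 8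
          · have e1 := hρ_3 p (by omega) h3
            have := hlt2 ⟨p - 2, by omega⟩ (by simp; omega) (by simp; omega)
            rw [if_neg (by omega), if_neg (by omega), if_neg (by omega), if_pos (by omega), e1, Nat.add_sub_cancel]
            have e2 := htwin2 ⟨p - 2, by omega⟩ (by simp; omega) (by simp; omega)
            have e3 : (⟨((⟨(p : ℕ) - 2, by omega⟩ : Fin (N * 2)) : ℕ) + 2, by simp; omega⟩ : Fin (N * 2)) = p :=
              Fin.ext (by simp; omega)
            rw [e3] at e2
            rw [e2]
          · rw [hρ_ge p (by omega), if_neg h0, if_neg h1, if_neg h2, if_neg h3]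
            exact harm p (by omega)
  have key := congrFun (StdFilling.wordPerm_polytabloid_of_mem_colStab (k := ℂ) hN T hρC)
    (StdFilling.rowWord hN T)
  rw [wordPerm_apply, ← hw, Pi.smul_apply, StdFilling.polytabloid_apply_rowWord, smul_eq_mul,
    mul_one] at key
  rw [key]
  have hs : Equiv.Perm.sign ρ = 1 := by
    show Equiv.Perm.sign (ρ₀ * (κ * ρ₀ * κ)) = 1
    simp only [Equiv.Perm.sign_mul]
    rcases Int.units_eq_one_or (Equiv.Perm.sign ρ₀) with h1 | h1 <;>
    rcases Int.units_eq_one_or (Equiv.Perm.sign κ) with h2 | h2 <;> simp [h1, h2]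
  rw [hs]
  simp

/-- **Even swaps.**  `e_T(u ∘ q) = e_T(u)` for the even column permutation `q = (2 3)(6 7)`. [folklore] -/
theorem dominoTableau_evenSwap {N : ℕ} {Y : YoungDiagram} (hN : ∀ x ∈ Y.cells, x.1 < N)
    (T : StdFilling (N * 2) Y)
    (hT : ∀ p : Fin (N * 2), T.1 p = (if (p : ℕ) < 2 then ((p : ℕ), 0) else if (p : ℕ) < 4 then ((p : ℕ) - 2, 1)
      else if (p : ℕ) < 6 then ((p : ℕ) - 4, 2) else if (p : ℕ) < 8 then ((p : ℕ) - 6, 3) else (0, (p : ℕ) - 4)))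
    (p2 p3 p6 p7 : Fin (N * 2)) (hp2 : (p2 : ℕ) = 2) (hp3 : (p3 : ℕ) = 3) (hp6 : (p6 : ℕ) = 6)
    (hp7 : (p7 : ℕ) = 7) (u : Word N (N * 2)) :
    T.polytabloid ℂ hN (u ∘ ⇑(Equiv.swap p2 p3 * Equiv.swap p6 p7)) = T.polytabloid ℂ hN u := by
  classical
  have hcol' : ∀ q : Fin (N * 2), (T.1 q).2 =
      if (q : ℕ) < 2 then 0 else if (q : ℕ) < 4 then 1
      else if (q : ℕ) < 6 then 2 else if (q : ℕ) < 8 then 3 else (q : ℕ) - 4 := fun q => by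
    rw [hT]; split_ifs <;> rfl
  set q : Equiv.Perm (Fin (N * 2)) := Equiv.swap p2 p3 * Equiv.swap p6 p7 with hq
  have hqv : ∀ x : Fin (N * 2), ((q x : Fin (N * 2)) : ℕ) =
      if (x : ℕ) = 2 then 3 else if (x : ℕ) = 3 then 2 else if (x : ℕ) = 6 then 7 else if (x : ℕ) = 7 then 6
      else (x : ℕ) := by
    intro x
    rw [hq, Equiv.Perm.mul_apply, Equiv.swap_apply_def, Equiv.swap_apply_def]
    simp only [Fin.ext_iff, hp2, hp3, hp6, hp7]
    split_ifs <;> omega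
  have hqC : q ∈ T.colStab := by
    rw [StdFilling.mem_colStab]
    intro x
    rw [hcol', hcol', hqv]
    split_ifs <;> omega
  have key := congrFun (StdFilling.wordPerm_polytabloid_of_mem_colStab (k := ℂ) hN T hqC) u
  rw [wordPerm_apply, Pi.smul_apply, smul_eq_mul] at key
  rw [key]
  have hs : Equiv.Perm.sign q = 1 := by
    rw [hq, Equiv.Perm.sign_mul, Equiv.Perm.sign_swap (fun h => by rw [Fin.ext_iff, hp2, hp3] at h; omega),
      Equiv.Perm.sign_swap (fun h => by rw [Fin.ext_iff, hp6, hp7] at h; omega)]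
    decide
  rw [hs]
  simp

end Summit.MatrixMultiplication.MatrixMultiplication.Theorems.ObstructionCalculus
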